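import Mathlib
import Literature.Geometry.Lorentzian.KerrSchild
import Literature.Geometry.Lorentzian.KerrEnergyIdentity
import Literature.Analysis.FunctionSpaces.ParametricIntegralSmooth

/-!
# Route StarvedNecks — crux `NecksCertify`, line `two-cap-focusing-ledger`: rung R1a-ii

Stub `stub_sphericalMeansCalculus` (statement `SphereMeanDarboux → SphericalMeansCalculus` of the
line skeleton, both unfolded, verbatim): the calculus of the time-dependent spherical means
`A(s, r) = ∫_{S²} ψ(s, x + r w) dσ(w)` of a smooth `ψ : E4 → ℝ` about a spatial centre `x : E3`
(`σ = volume.toSphere`, the finite surface measure on the unit sphere of `E3`):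

* `A` is jointly smooth on `ℝ²` — the integrand `(w, (s, r)) ↦ ψ(s, x + r w)` is jointly smooth and
  the integration variable ranges over a compact set, so the tree's
  `Literature.Analysis.FunctionSpaces.contDiff_parametric_integral` applies;
* `∂ᵣA = ∫ Dψ(s, x + rw)·(0, w)`, `∂ₛA = ∫ ∂₀ψ(s, x + rw)`, `∂ₛ²A = ∫ ∂₀∂₀ψ(s, x + rw)` — one
  derivative under the integral sign (`fderiv_parametric_integral_apply`) plus the chain rule
  through the affine maps `s ↦ (s, y) = s ∂₀ + (0, y)` and `ρ ↦ (s, x + ρw) = (s, x) + ρ (0, w)`;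
* DARBOUX in the radius, `∂ᵣ²(r A(s, r)) = r ∫ (Δₓψ)(s, x + rw) dσ`: the hypothesis
  `SphereMeanDarboux` applied to the slice `f = ψ ∘ E4.ofTimeSpace s`, whose coordinate second
  derivatives are those of `ψ` along `∂₁, ∂₂, ∂₃` (chain rule through the slice map, whose linear
  part `E4.spaceEmbed` sends `eᵢ` to `∂_{i+1}`).

Mathlib + the tree (`E4.spaceEmbed`, `E4.ofTimeSpace_eq_smul_add'` of
`Literature.Geometry.Lorentzian.KerrEnergyIdentity`; `contDiff_parametric_integral`,
`differentiable_parametric_integral`, `fderiv_parametric_integral_apply` of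
`Literature.Analysis.FunctionSpaces.ParametricIntegralSmooth`); no definitions, no named facts.
-/

noncomputable section

open scoped Manifold ContDiff Topology ENNReal
open Filter Set MeasureTheory Topology Literature.Geometry.Lorentzian

-- the doubled `FinalStateConjecture.FinalStateConjecture` path component trips dupNamespace
set_option linter.dupNamespace false

namespace Summit.FinalStateConjecture.FinalStateConjecture.Theorems.NecksCertifyTwoCap.SphericalMeans

open Literature.Analysis.FunctionSpaces

/-! ### The affine slice maps -/

/-- `(s, y) = s ∂₀ + (0, y)`: the time line through `(0, y)` has velocity `∂₀`. -/
theorem hasDerivAt_ofTimeSpace_time (y : E3) (s : ℝ) :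
    HasDerivAt (fun s' : ℝ ↦ E4.ofTimeSpace s' y) (E4.basisVector 0) s := by
  have h : (fun s' : ℝ ↦ E4.ofTimeSpace s' y) =
      fun s' ↦ s' • E4.basisVector 0 + E4.spaceEmbed y :=
    funext fun s' ↦ E4.ofTimeSpace_eq_smul_add' s' y
  rw [h]
  exact (((hasDerivAt_id s).smul_const (E4.basisVector 0)).add_const
    (E4.spaceEmbed y)).congr_deriv (one_smul _ _)

/-- `(s, x + ρ w) = (s, x) + ρ (0, w)`. -/
theorem ofTimeSpace_add_smul (s : ℝ) (x w : E3) (ρ : ℝ) :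
    E4.ofTimeSpace s (x + ρ • w) = E4.ofTimeSpace s x + ρ • E4.ofTimeSpace 0 w := by
  rw [E4.ofTimeSpace_eq_smul_add', E4.ofTimeSpace_eq_smul_add' s x, ← E4.spaceEmbed_apply,
    map_add, map_smul, add_assoc]

/-- The radial line `ρ ↦ (s, x + ρ w)` has velocity `(0, w)`. -/
theorem hasDerivAt_ofTimeSpace_radius (s : ℝ) (x w : E3) (ρ : ℝ) :
    HasDerivAt (fun ρ' : ℝ ↦ E4.ofTimeSpace s (x + ρ' • w)) (E4.ofTimeSpace 0 w) ρ := by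
  have h : (fun ρ' : ℝ ↦ E4.ofTimeSpace s (x + ρ' • w)) =
      fun ρ' ↦ E4.ofTimeSpace s x + ρ' • E4.ofTimeSpace 0 w :=
    funext fun ρ' ↦ ofTimeSpace_add_smul s x w ρ'
  rw [h]
  exact (((hasDerivAt_id ρ).smul_const (E4.ofTimeSpace 0 w)).const_add
    (E4.ofTimeSpace s x)).congr_deriv (one_smul _ _)

/-- The slice map `y ↦ (s, y)` is affine with differential `E4.spaceEmbed`. -/
theorem hasFDerivAt_ofTimeSpace_space (s : ℝ) (y : E3) :
    HasFDerivAt (E4.ofTimeSpace s) E4.spaceEmbed y := by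
  have h : E4.ofTimeSpace s = fun y ↦ s • E4.basisVector 0 + E4.spaceEmbed y :=
    funext fun y ↦ E4.ofTimeSpace_eq_smul_add' s y
  rw [h]
  exact E4.spaceEmbed.hasFDerivAt.const_add _

/-- The slice map `y ↦ (s, y)` is smooth. -/
theorem contDiff_ofTimeSpace_space (s : ℝ) : ContDiff ℝ ∞ (E4.ofTimeSpace s) := by
  have h : E4.ofTimeSpace s = fun y ↦ s • E4.basisVector 0 + E4.spaceEmbed y :=
    funext fun y ↦ E4.ofTimeSpace_eq_smul_add' s y
  rw [h]
  exact contDiff_const.add E4.spaceEmbed.contDiff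

/-- `(0, eᵢ) = ∂_{i+1}`. -/
theorem ofTimeSpace_zero_single (i : Fin 3) :
    E4.ofTimeSpace 0 (EuclideanSpace.single i (1 : ℝ)) = E4.basisVector i.succ := by
  ext k
  refine Fin.cases ?_ (fun j ↦ ?_) k
  · simp [Fin.succ_ne_zero]
  · simp

/-- Chain rule through the slice map on coordinate vectors:
`∂ᵢ(φ(s, ·))(y) = (∂_{i+1}φ)(s, y)`. -/
theorem fderiv_comp_ofTimeSpace_single {φ : E4 → ℝ} (hφ : Differentiable ℝ φ) (s : ℝ)
    (y : E3) (i : Fin 3) :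
    fderiv ℝ (fun z ↦ φ (E4.ofTimeSpace s z)) y (EuclideanSpace.single i (1 : ℝ)) =
      fderiv ℝ φ (E4.ofTimeSpace s y) (E4.basisVector i.succ) := by
  have h : HasFDerivAt (fun z ↦ φ (E4.ofTimeSpace s z))
      ((fderiv ℝ φ (E4.ofTimeSpace s y)).comp E4.spaceEmbed) y :=
    (hφ _).hasFDerivAt.comp y (hasFDerivAt_ofTimeSpace_space s y)
  rw [h.fderiv, ContinuousLinearMap.comp_apply, E4.spaceEmbed_apply, ofTimeSpace_zero_single]

/-- The map `(w, (s, r)) ↦ (s, x + r w)` is jointly smooth. -/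
theorem contDiff_sliceMap (x : E3) :
    ContDiff ℝ ∞ fun q : E3 × (ℝ × ℝ) ↦ E4.ofTimeSpace q.2.1 (x + q.2.2 • q.1) := by
  have h : (fun q : E3 × (ℝ × ℝ) ↦ E4.ofTimeSpace q.2.1 (x + q.2.2 • q.1)) =
      fun q ↦ q.2.1 • E4.basisVector 0 + E4.spaceEmbed (x + q.2.2 • q.1) :=
    funext fun q ↦ E4.ofTimeSpace_eq_smul_add' _ _
  rw [h]
  exact ((contDiff_fst.comp contDiff_snd).smul contDiff_const).add
    (E4.spaceEmbed.contDiff.comp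
      (contDiff_const.add ((contDiff_snd.comp contDiff_snd).smul contDiff_fst)))

/-! ### Spherical means: smoothness and one derivative under the integral sign -/

/-- **Joint smoothness** of `(s, r) ↦ ∫_{S²} ψ(s, x + r w) dσ(w)` for smooth `ψ`. -/
theorem contDiff_sphericalMean {ψ : E4 → ℝ} (hψ : ContDiff ℝ ∞ ψ) (x : E3) :
    ContDiff ℝ ∞ fun p : ℝ × ℝ ↦ ∫ (w : Metric.sphere (0 : E3) 1),
      ψ (E4.ofTimeSpace p.1 (x + p.2 • (w : E3))) ∂((volume : Measure E3).toSphere) :=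
  contDiff_parametric_integral (μ := (volume : Measure E3).toSphere)
    (ι := (Subtype.val : Metric.sphere (0 : E3) 1 → E3)) measurable_subtype_coe
    (isCompact_sphere (0 : E3) 1) (Eventually.of_forall fun w ↦ w.2)
    (G := fun q : E3 × (ℝ × ℝ) ↦ ψ (E4.ofTimeSpace q.2.1 (x + q.2.2 • q.1)))
    (hψ.comp (contDiff_sliceMap x))

/-- **Time derivative under the integral sign**:
`∂ₛ ∫ ψ(s, x + rw) dσ = ∫ ∂₀ψ(s, x + rw) dσ`. -/
theorem hasDerivAt_sphericalMean_time {ψ : E4 → ℝ} (hψ : ContDiff ℝ ∞ ψ) (x : E3)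
    (r s : ℝ) :
    HasDerivAt (fun s' : ℝ ↦ ∫ (w : Metric.sphere (0 : E3) 1),
        ψ (E4.ofTimeSpace s' (x + r • (w : E3))) ∂((volume : Measure E3).toSphere))
      (∫ (w : Metric.sphere (0 : E3) 1), fderiv ℝ ψ (E4.ofTimeSpace s (x + r • (w : E3)))
        (E4.basisVector 0) ∂((volume : Measure E3).toSphere)) s := by
  have hn : (∞ : WithTop ℕ∞) ≠ 0 := by exact_mod_cast WithTop.coe_ne_zero.2 (by decide)
  have hG : ContDiff ℝ ∞ fun q : E3 × ℝ ↦ ψ (E4.ofTimeSpace q.2 (x + r • q.1)) :=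
    hψ.comp ((contDiff_sliceMap x).comp
      (contDiff_fst.prodMk (contDiff_snd.prodMk contDiff_const) :
        ContDiff ℝ ∞ fun q : E3 × ℝ ↦ ((q.1, (q.2, r)) : E3 × (ℝ × ℝ))))
  have hd : DifferentiableAt ℝ (fun s' : ℝ ↦ ∫ (w : Metric.sphere (0 : E3) 1),
      ψ (E4.ofTimeSpace s' (x + r • (w : E3))) ∂((volume : Measure E3).toSphere)) s :=
    differentiable_parametric_integral (μ := (volume : Measure E3).toSphere)
      (ι := (Subtype.val : Metric.sphere (0 : E3) 1 → E3)) measurable_subtype_coe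
      (isCompact_sphere (0 : E3) 1) (Eventually.of_forall fun w ↦ w.2)
      (G := fun q : E3 × ℝ ↦ ψ (E4.ofTimeSpace q.2 (x + r • q.1))) hG hn s
  have h1 : deriv (fun s' : ℝ ↦ ∫ (w : Metric.sphere (0 : E3) 1),
      ψ (E4.ofTimeSpace s' (x + r • (w : E3))) ∂((volume : Measure E3).toSphere)) s =
      ∫ (w : Metric.sphere (0 : E3) 1),
        fderiv ℝ (fun q : E3 × ℝ ↦ ψ (E4.ofTimeSpace q.2 (x + r • q.1)))
          ((w : E3), s) ((0 : E3), (1 : ℝ)) ∂((volume : Measure E3).toSphere) := by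
    rw [← fderiv_apply_one_eq_deriv]
    exact fderiv_parametric_integral_apply (μ := (volume : Measure E3).toSphere)
      (ι := (Subtype.val : Metric.sphere (0 : E3) 1 → E3)) measurable_subtype_coe
      (isCompact_sphere (0 : E3) 1) (Eventually.of_forall fun w ↦ w.2)
      (G := fun q : E3 × ℝ ↦ ψ (E4.ofTimeSpace q.2 (x + r • q.1))) hG hn s 1
  have h2 : ∀ w : E3, fderiv ℝ (fun q : E3 × ℝ ↦ ψ (E4.ofTimeSpace q.2 (x + r • q.1)))
      (w, s) ((0 : E3), (1 : ℝ)) =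
      fderiv ℝ ψ (E4.ofTimeSpace s (x + r • w)) (E4.basisVector 0) := by
    intro w
    have hA : HasDerivAt (fun s' : ℝ ↦ ψ (E4.ofTimeSpace s' (x + r • w)))
        (fderiv ℝ (fun q : E3 × ℝ ↦ ψ (E4.ofTimeSpace q.2 (x + r • q.1))) (w, s)
          ((0 : E3), (1 : ℝ))) s :=
      ((hG.differentiable hn) (w, s)).hasFDerivAt.comp_hasDerivAt s
        ((hasDerivAt_const s w).prodMk (hasDerivAt_id s))
    have hB : HasDerivAt (fun s' : ℝ ↦ ψ (E4.ofTimeSpace s' (x + r • w)))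
        (fderiv ℝ ψ (E4.ofTimeSpace s (x + r • w)) (E4.basisVector 0)) s :=
      ((hψ.differentiable hn) _).hasFDerivAt.comp_hasDerivAt s
        (hasDerivAt_ofTimeSpace_time (x + r • w) s)
    exact hA.unique hB
  refine hd.hasDerivAt.congr_deriv ?_
  rw [h1]
  exact integral_congr_ae (Eventually.of_forall fun w ↦ h2 (w : E3))

/-- **Radial derivative under the integral sign**:
`∂ᵣ ∫ ψ(s, x + rw) dσ = ∫ Dψ(s, x + rw)·(0, w) dσ`. -/
theorem hasDerivAt_sphericalMean_radius {ψ : E4 → ℝ} (hψ : ContDiff ℝ ∞ ψ) (x : E3)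
    (s r : ℝ) :
    HasDerivAt (fun ρ : ℝ ↦ ∫ (w : Metric.sphere (0 : E3) 1),
        ψ (E4.ofTimeSpace s (x + ρ • (w : E3))) ∂((volume : Measure E3).toSphere))
      (∫ (w : Metric.sphere (0 : E3) 1), fderiv ℝ ψ (E4.ofTimeSpace s (x + r • (w : E3)))
        (E4.ofTimeSpace 0 (w : E3)) ∂((volume : Measure E3).toSphere)) r := by
  have hn : (∞ : WithTop ℕ∞) ≠ 0 := by exact_mod_cast WithTop.coe_ne_zero.2 (by decide)
  have hG : ContDiff ℝ ∞ fun q : E3 × ℝ ↦ ψ (E4.ofTimeSpace s (x + q.2 • q.1)) :=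
    hψ.comp ((contDiff_sliceMap x).comp
      (contDiff_fst.prodMk (contDiff_const.prodMk contDiff_snd) :
        ContDiff ℝ ∞ fun q : E3 × ℝ ↦ ((q.1, (s, q.2)) : E3 × (ℝ × ℝ))))
  have hd : DifferentiableAt ℝ (fun ρ : ℝ ↦ ∫ (w : Metric.sphere (0 : E3) 1),
      ψ (E4.ofTimeSpace s (x + ρ • (w : E3))) ∂((volume : Measure E3).toSphere)) r :=
    differentiable_parametric_integral (μ := (volume : Measure E3).toSphere)
      (ι := (Subtype.val : Metric.sphere (0 : E3) 1 → E3)) measurable_subtype_coe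
      (isCompact_sphere (0 : E3) 1) (Eventually.of_forall fun w ↦ w.2)
      (G := fun q : E3 × ℝ ↦ ψ (E4.ofTimeSpace s (x + q.2 • q.1))) hG hn r
  have h1 : deriv (fun ρ : ℝ ↦ ∫ (w : Metric.sphere (0 : E3) 1),
      ψ (E4.ofTimeSpace s (x + ρ • (w : E3))) ∂((volume : Measure E3).toSphere)) r =
      ∫ (w : Metric.sphere (0 : E3) 1),
        fderiv ℝ (fun q : E3 × ℝ ↦ ψ (E4.ofTimeSpace s (x + q.2 • q.1)))
          ((w : E3), r) ((0 : E3), (1 : ℝ)) ∂((volume : Measure E3).toSphere) := by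
    rw [← fderiv_apply_one_eq_deriv]
    exact fderiv_parametric_integral_apply (μ := (volume : Measure E3).toSphere)
      (ι := (Subtype.val : Metric.sphere (0 : E3) 1 → E3)) measurable_subtype_coe
      (isCompact_sphere (0 : E3) 1) (Eventually.of_forall fun w ↦ w.2)
      (G := fun q : E3 × ℝ ↦ ψ (E4.ofTimeSpace s (x + q.2 • q.1))) hG hn r 1
  have h2 : ∀ w : E3, fderiv ℝ (fun q : E3 × ℝ ↦ ψ (E4.ofTimeSpace s (x + q.2 • q.1)))
      (w, r) ((0 : E3), (1 : ℝ)) =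
      fderiv ℝ ψ (E4.ofTimeSpace s (x + r • w)) (E4.ofTimeSpace 0 w) := by
    intro w
    have hA : HasDerivAt (fun ρ : ℝ ↦ ψ (E4.ofTimeSpace s (x + ρ • w)))
        (fderiv ℝ (fun q : E3 × ℝ ↦ ψ (E4.ofTimeSpace s (x + q.2 • q.1))) (w, r)
          ((0 : E3), (1 : ℝ))) r :=
      ((hG.differentiable hn) (w, r)).hasFDerivAt.comp_hasDerivAt r
        ((hasDerivAt_const r w).prodMk (hasDerivAt_id r))
    have hB : HasDerivAt (fun ρ : ℝ ↦ ψ (E4.ofTimeSpace s (x + ρ • w)))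
        (fderiv ℝ ψ (E4.ofTimeSpace s (x + r • w)) (E4.ofTimeSpace 0 w)) r :=
      ((hψ.differentiable hn) _).hasFDerivAt.comp_hasDerivAt r
        (hasDerivAt_ofTimeSpace_radius s x w r)
    exact hA.unique hB
  refine hd.hasDerivAt.congr_deriv ?_
  rw [h1]
  exact integral_congr_ae (Eventually.of_forall fun w ↦ h2 (w : E3))

/-! ### The registered stub -/

/-- **R1a-ii — calculus of time-dependent spherical means** (classical; Evans, PDE, §2.4.1),
registered stub `stub_sphericalMeansCalculus` of the line `two-cap-focusing-ledger`
(statement `SphereMeanDarboux → SphericalMeansCalculus`, both unfolded, verbatim).  For a smooth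
`ψ : E4 → ℝ`, a spatial centre `x : E3` and `A(s, r) := ∫_{S²} ψ(s, x + r w) dσ(w)` (pinned by its
defining equation): `A` is jointly smooth on `ℝ²` (`contDiff_sphericalMean`); `∂ᵣA = ∫ Dψ·(0,w)`
(`hasDerivAt_sphericalMean_radius`), `∂ₛA = ∫ ∂₀ψ` and `∂ₛ²A = ∫ ∂₀∂₀ψ`
(`hasDerivAt_sphericalMean_time`, applied to `ψ` and to `∂₀ψ`); and Darboux in the radius,
`∂ᵣ²(r A(s,r)) = r ∫ (Δₓψ)(s, x + rw) dσ` — the hypothesis applied to the slice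
`f = ψ ∘ E4.ofTimeSpace s` plus the chain rule `fderiv_comp_ofTimeSpace_single` (twice). -/
theorem stub_sphericalMeansCalculus :
  (∀ (f : E3 → ℝ), ContDiff ℝ ∞ f → ∀ (x : E3),
    ContDiff ℝ ∞ (fun ρ : ℝ ↦ ∫ (w : Metric.sphere (0 : E3) 1), f (x + ρ • (w : E3)) ∂((volume : Measure E3).toSphere)) ∧
    (∀ r : ℝ, deriv (fun ρ : ℝ ↦ ∫ (w : Metric.sphere (0 : E3) 1), f (x + ρ • (w : E3)) ∂((volume : Measure E3).toSphere)) r =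
      ∫ (w : Metric.sphere (0 : E3) 1), fderiv ℝ f (x + r • (w : E3)) (w : E3) ∂((volume : Measure E3).toSphere)) ∧
    (∀ r : ℝ, iteratedDeriv 2 (fun ρ : ℝ ↦ ρ * ∫ (w : Metric.sphere (0 : E3) 1), f (x + ρ • (w : E3)) ∂((volume : Measure E3).toSphere)) r =
      r * ∫ (w : Metric.sphere (0 : E3) 1), (∑ i : Fin 3, fderiv ℝ (fun z ↦ fderiv ℝ f z (EuclideanSpace.single i (1 : ℝ)))
        (x + r • (w : E3)) (EuclideanSpace.single i (1 : ℝ))) ∂((volume : Measure E3).toSphere))) →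
  ∀ (ψ : E4 → ℝ), ContDiff ℝ ∞ ψ → ∀ (x : E3) (A : ℝ → ℝ → ℝ),
    (∀ s r, A s r = ∫ (w : Metric.sphere (0 : E3) 1), ψ (E4.ofTimeSpace s (x + r • (w : E3))) ∂((volume : Measure E3).toSphere)) →
    ContDiff ℝ ∞ (Function.uncurry A) ∧
    (∀ s r, deriv (A s) r =
      ∫ (w : Metric.sphere (0 : E3) 1), fderiv ℝ ψ (E4.ofTimeSpace s (x + r • (w : E3))) (E4.ofTimeSpace 0 (w : E3)) ∂((volume : Measure E3).toSphere)) ∧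
    (∀ s r, deriv (fun s' ↦ A s' r) s =
      ∫ (w : Metric.sphere (0 : E3) 1), fderiv ℝ ψ (E4.ofTimeSpace s (x + r • (w : E3))) (E4.basisVector 0) ∂((volume : Measure E3).toSphere)) ∧
    (∀ s r, iteratedDeriv 2 (fun s' ↦ A s' r) s =
      ∫ (w : Metric.sphere (0 : E3) 1), fderiv ℝ (fun z ↦ fderiv ℝ ψ z (E4.basisVector 0)) (E4.ofTimeSpace s (x + r • (w : E3))) (E4.basisVector 0) ∂((volume : Measure E3).toSphere)) ∧
    (∀ s r, iteratedDeriv 2 (fun ρ ↦ ρ * A s ρ) r =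
      r * ∫ (w : Metric.sphere (0 : E3) 1), (∑ i : Fin 3, fderiv ℝ (fun z ↦ fderiv ℝ ψ z (E4.basisVector i.succ)) (E4.ofTimeSpace s (x + r • (w : E3)))
        (E4.basisVector i.succ)) ∂((volume : Measure E3).toSphere)) := by
  intro hD ψ hψ x A hA
  have hn : (∞ : WithTop ℕ∞) ≠ 0 := by exact_mod_cast WithTop.coe_ne_zero.2 (by decide)
  -- the pinned `A` as explicit parametric integrals
  have hAu : Function.uncurry A = fun p : ℝ × ℝ ↦ ∫ (w : Metric.sphere (0 : E3) 1),
      ψ (E4.ofTimeSpace p.1 (x + p.2 • (w : E3))) ∂((volume : Measure E3).toSphere) :=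
    funext fun p ↦ hA p.1 p.2
  have hAr : ∀ s, A s = fun ρ : ℝ ↦ ∫ (w : Metric.sphere (0 : E3) 1),
      ψ (E4.ofTimeSpace s (x + ρ • (w : E3))) ∂((volume : Measure E3).toSphere) :=
    fun s ↦ funext (hA s)
  have hAs : ∀ r, (fun s' ↦ A s' r) = fun s' : ℝ ↦ ∫ (w : Metric.sphere (0 : E3) 1),
      ψ (E4.ofTimeSpace s' (x + r • (w : E3))) ∂((volume : Measure E3).toSphere) :=
    fun r ↦ funext fun s' ↦ hA s' r
  refine ⟨?_, fun s r ↦ ?_, fun s r ↦ ?_, fun s r ↦ ?_, fun s r ↦ ?_⟩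
  · -- (1) joint smoothness
    rw [hAu]
    exact contDiff_sphericalMean hψ x
  · -- (2) radial derivative
    rw [hAr s]
    exact (hasDerivAt_sphericalMean_radius hψ x s r).deriv
  · -- (3) time derivative
    rw [hAs r]
    exact (hasDerivAt_sphericalMean_time hψ x r s).deriv
  · -- (4) second time derivative: (3) for `ψ`, then (3) for `∂₀ψ`
    have hψ₀ : ContDiff ℝ ∞ fun z ↦ fderiv ℝ ψ z (E4.basisVector 0) :=
      (hψ.fderiv_right (m := ∞) le_rfl).clm_apply contDiff_const
    have h1 : deriv (fun s' ↦ A s' r) = fun s' : ℝ ↦ ∫ (w : Metric.sphere (0 : E3) 1),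
        fderiv ℝ ψ (E4.ofTimeSpace s' (x + r • (w : E3))) (E4.basisVector 0)
          ∂((volume : Measure E3).toSphere) := by
      rw [hAs r]
      exact funext fun s' ↦ (hasDerivAt_sphericalMean_time hψ x r s').deriv
    rw [iteratedDeriv_succ, iteratedDeriv_one, h1]
    exact (hasDerivAt_sphericalMean_time hψ₀ x r s).deriv
  · -- (5) Darboux in the radius: the hypothesis on the slice `f = ψ(s, ·)` + the chain rule
    have hf : ContDiff ℝ ∞ fun y : E3 ↦ ψ (E4.ofTimeSpace s y) :=
      hψ.comp (contDiff_ofTimeSpace_space s)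
    have hρ : (fun ρ : ℝ ↦ ρ * A s ρ) = fun ρ : ℝ ↦
        ρ * ∫ (w : Metric.sphere (0 : E3) 1),
          ψ (E4.ofTimeSpace s (x + ρ • (w : E3))) ∂((volume : Measure E3).toSphere) :=
      funext fun ρ ↦ by rw [hA]
    have hD3 := (hD _ hf x).2.2 r
    rw [hρ]
    refine hD3.trans ?_
    congr 1
    refine integral_congr_ae (Eventually.of_forall fun w ↦ ?_)
    refine Finset.sum_congr rfl fun i _ ↦ ?_
    have hψi : ContDiff ℝ ∞ fun z ↦ fderiv ℝ ψ z (E4.basisVector i.succ) :=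
      (hψ.fderiv_right (m := ∞) le_rfl).clm_apply contDiff_const
    have heq : (fun z : E3 ↦ fderiv ℝ (fun y : E3 ↦ ψ (E4.ofTimeSpace s y)) z
        (EuclideanSpace.single i (1 : ℝ))) =
        fun z : E3 ↦
          (fun z' : E4 ↦ fderiv ℝ ψ z' (E4.basisVector i.succ)) (E4.ofTimeSpace s z) :=
      funext fun z ↦ fderiv_comp_ofTimeSpace_single (hψ.differentiable hn) s z i
    rw [heq, fderiv_comp_ofTimeSpace_single (hψi.differentiable hn) s (x + r • (w : E3)) i]

end Summit.FinalStateConjecture.FinalStateConjecture.Theorems.NecksCertifyTwoCap.SphericalMeans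

end
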